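import Summits.ResolutionOfSingularities.ResolutionOfSingularities.Theorems.FrobeniusLadderFInjectiveMacaulayficationClauseOfPderivNotMem
import Mathlib.Algebra.MvPolynomial.PDeriv
import Mathlib.Algebra.CharP.Algebra
import Mathlib.Tactic.LinearCombination
import HarnessLib

/-!
# ROWC row F211 at `p = 5`: the off-axis clause `hoff` — `V(g)` is REGULAR off the `t`-axis
# (crux `FInjectiveMacaulayfication` stmt-ResolutionOfSingularities-15315, relative filtered engine v2; RULING R16.6 (2) of res-L1-w45a-plan-1)

Support file for crux stmt-ResolutionOfSingularities-15315 (`FrobeniusLadder.FInjectiveMacaulayfication`), chain w45a, seat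
res-L1-w45a-stub-4 g6. [OURS · L1 W4.5a; template = res-L1-w45a-stub-2's `RelGddF008Regular` (residue-domain chain); HOFF audit
res-L1-w45a-tri-1 j288098: F211 is an ∅-row (`Sing X ∖ L = ∅`)] — NOT a statement of the manuscript; AI-written, weaker than
expert review.

For the diagonal form `g = z² + t⁴y²w⁴ + (y² + x³)³ + y⁵w + x¹¹ + w⁷` of F192 (`…RelGddF211Data`) over any field of characteristic `5`:
at every maximal ideal `Q` of `k[x,y,z,w,t]/(g)` missing some `x̄ⱼ`, `j ∈ {x,y,z,w}`, some partial derivative of `g` is NOT in `Q`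
(`eq_zero_of_jacobian`: in a domain of characteristic `5`, `g = ∇g = 0` forces `x = y = z = w = 0` — `∂_z = 2z`; if `w = 0` then
`∂_y` gives `yφ² = 0` and `g` gives `φ³ + x¹¹ = 0`, whence `x = y = 0` as for F008; if `w ≠ 0` then `∂_t = 4t³y²w⁴` gives `t³y² = 0`,
`y = 0` makes `∂_w` read `7w⁶ = 0`, and `t = 0` gives `φ = 0` (`∂_y`), `x = 0` (`∂_x`), `y = 0`), so the local ring is regular and satisfies the clause (`ClauseOfPderivNotMem`).
Main theorem `g_offL_clause_char5` = the engine's `hoff` for `n = 5`, `J = {0,1,2,3}`, `p = 5`.  No definitions, no named facts. [folklore]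
-/

-- single-problem summit: the doubled namespace component is forced
set_option linter.dupNamespace false

noncomputable section

namespace Summit.ResolutionOfSingularities.ResolutionOfSingularities.Theorems.FInjectiveMacaulayfication.RelGddF211Regular

open MvPolynomial
open Summit.ResolutionOfSingularities.ResolutionOfSingularities.Theorems.FInjectiveMacaulayfication

/-- **THE RESIDUE-DOMAIN CHAIN.** In a domain `R` of characteristic `5`, the five equations `∇g = 0` together with `g = 0` force
`x = y = z = w = 0`. [folklore] -/
theorem eq_zero_of_jacobian {R : Type} [CommRing R] [IsDomain R] (h5 : (5 : R) = 0) (x y z w t : R)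
    (eg : z ^ 2 + t ^ 4 * y ^ 2 * w ^ 4 + (y ^ 2 + x ^ 3) ^ 3 + y ^ 5 * w + x ^ 11 + w ^ 7 = 0)
    (e0 : 9 * x ^ 2 * (y ^ 2 + x ^ 3) ^ 2 + 11 * x ^ 10 = 0)
    (e1 : 2 * t ^ 4 * y * w ^ 4 + 6 * y * (y ^ 2 + x ^ 3) ^ 2 + 5 * y ^ 4 * w = 0)
    (e2 : 2 * z = 0)
    (e3 : 4 * t ^ 4 * y ^ 2 * w ^ 3 + y ^ 5 + 7 * w ^ 6 = 0)
    (e4 : 4 * t ^ 3 * y ^ 2 * w ^ 4 = 0) :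
    x = 0 ∧ y = 0 ∧ z = 0 ∧ w = 0 := by
  have h23 : (2 : R) * 3 = 1 := by linear_combination h5
  have hz : z = 0 := by linear_combination 3 * e2 - z * h5
  by_cases hw : w = 0
  · /- CASE `w = 0` (exactly as for F192: the terms `y⁵w`, `5y⁴w` vanish) -/
    have f1 : y * (y ^ 2 + x ^ 3) ^ 2 = 0 := by
      linear_combination e1 - (y * (y ^ 2 + x ^ 3) ^ 2 + y ^ 4 * w) * h5 - 2 * t ^ 4 * y * w ^ 3 * hw
    have fg : (y ^ 2 + x ^ 3) ^ 3 + x ^ 11 = 0 := by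
      linear_combination eg - z * hz - (t ^ 4 * y ^ 2 * w ^ 3 + y ^ 5 + w ^ 6) * hw
    by_cases hy : y = 0
    · by_cases hx : x = 0
      · exact ⟨hx, hy, hz, hw⟩
      · exfalso
        have h1 : x ^ 8 * (11 * x ^ 2 + 9) = 0 := by
          linear_combination e0 - 9 * x ^ 2 * ((y ^ 2 + x ^ 3) + x ^ 3) * y * hy
        have h2 : x ^ 9 * (x ^ 2 + 1) = 0 := by
          linear_combination fg - ((y ^ 2 + x ^ 3) ^ 2 + (y ^ 2 + x ^ 3) * x ^ 3 + x ^ 6) * y * hy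
        have h1' : 11 * x ^ 2 + 9 = 0 := (mul_eq_zero.mp h1).resolve_left (pow_ne_zero 8 hx)
        have h2' : x ^ 2 + 1 = 0 := (mul_eq_zero.mp h2).resolve_left (pow_ne_zero 9 hx)
        have h20 : (2 : R) = 0 := by linear_combination -h1' + 11 * h2'
        have : (1 : R) = 0 := by linear_combination -h23 + 3 * h20
        exact one_ne_zero this
    · exfalso
      have hφ2 : (y ^ 2 + x ^ 3) ^ 2 = 0 := (mul_eq_zero.mp f1).resolve_left hy
      have hφ : y ^ 2 + x ^ 3 = 0 := pow_eq_zero_iff (two_ne_zero) |>.mp hφ2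
      have hx11 : x ^ 11 = 0 := by linear_combination fg - (y ^ 2 + x ^ 3) ^ 2 * hφ
      have hx : x = 0 := pow_eq_zero_iff (by norm_num) |>.mp hx11
      have hy2 : y ^ 2 = 0 := by linear_combination hφ - x ^ 2 * hx
      exact hy (pow_eq_zero_iff two_ne_zero |>.mp hy2)
  · /- CASE `w ≠ 0`: `∂_t` gives `t³y² = 0`; `y = 0` makes `∂_w` read `7w⁶ = 0`; `t = 0` gives `φ = 0`, `x = 0`, `y = 0` -/
    exfalso
    have hty : t ^ 3 * y ^ 2 = 0 := by
      have h : w ^ 4 * (t ^ 3 * y ^ 2) = 0 := by linear_combination 4 * e4 - 3 * t ^ 3 * y ^ 2 * w ^ 4 * h5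
      exact (mul_eq_zero.mp h).resolve_left (pow_ne_zero 4 hw)
    have hw6 : ∀ (_ : y = 0), False := fun hy => by
      have h : w ^ 6 = 0 := by
        linear_combination 3 * e3 - (3 * 4 * t ^ 4 * y * w ^ 3 + 3 * y ^ 4) * hy - (4 * w ^ 6) * h5
      exact hw (pow_eq_zero_iff (by norm_num) |>.mp h)
    rcases mul_eq_zero.mp hty with ht3 | hy2
    · have ht : t = 0 := pow_eq_zero_iff (by norm_num) |>.mp ht3
      -- `∂_y` gives `yφ² = 0`
      have f1 : y * (y ^ 2 + x ^ 3) ^ 2 = 0 := by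
        linear_combination e1 - (y * (y ^ 2 + x ^ 3) ^ 2 + y ^ 4 * w) * h5 - 2 * t ^ 3 * y * w ^ 4 * ht
      rcases mul_eq_zero.mp f1 with hy | hφ2
      · exact hw6 hy
      · have hφ : y ^ 2 + x ^ 3 = 0 := pow_eq_zero_iff (two_ne_zero) |>.mp hφ2
        -- `∂_x` gives `x = 0`, then `y = 0`
        have hx10 : x ^ 10 = 0 := by linear_combination e0 - 9 * x ^ 2 * (y ^ 2 + x ^ 3) * hφ - 2 * x ^ 10 * h5
        have hx : x = 0 := pow_eq_zero_iff (by norm_num) |>.mp hx10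
        have hy2 : y ^ 2 = 0 := by linear_combination hφ - x ^ 2 * hx
        exact hw6 (pow_eq_zero_iff two_ne_zero |>.mp hy2)
    · exact hw6 (pow_eq_zero_iff two_ne_zero |>.mp hy2)

/-- **THE OFF-AXIS CLAUSE `hoff` FOR `g = z² + t⁴w⁶ + (y² + x³)³ + t·x³y·w³ + x¹¹ + w⁷` AT `p = 5`** (RGDD-L row F008, diagonalised form):
at every maximal ideal `Q` of `k[X]/(g)` missing some `x̄ⱼ`, `j ∈ {0,1,2,3}`, the local ring satisfies the Cohen–Macaulay + Frobenius-closed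
clause — `V(g)` is regular off the `t`-axis (Jacobian: some partial is a unit at `Q`, by `eq_zero_of_jacobian` in the residue domain, then
`ClauseOfPderivNotMem`). Exact binder shape = the engine's `hoff` for `n = 5`, `J = {0,1,2,3}`, `p = 5`.
[cite: Matsumura1987, Thm. 30.4 (ii)] -/
theorem g_offL_clause_char5 (k : Type) [Field k] [CharP k 5] (g : MvPolynomial (Fin 5) k)
    (hg : g = X 2 ^ 2 + X 4 ^ 4 * X 1 ^ 2 * X 3 ^ 4 + (X 1 ^ 2 + X 0 ^ 3) ^ 3 + X 1 ^ 5 * X 3 + X 0 ^ 11 + X 3 ^ 7) :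
    ∀ (Q : Ideal (MvPolynomial (Fin 5) k ⧸ Ideal.span {g})) [Q.IsMaximal],
      (∃ j ∈ ({0, 1, 2, 3} : Finset (Fin 5)), Ideal.Quotient.mk (Ideal.span {g}) (MvPolynomial.X j) ∉ Q) →
      ∀ d : ℕ, ringKrullDim (Localization.AtPrime Q) = d → ∀ s : Fin d → Localization.AtPrime Q,
        (Ideal.span (Set.range s)).radical.IsMaximal →
          RingTheory.Sequence.IsWeaklyRegular (Localization.AtPrime Q) (List.ofFn s) ∧
          ∀ y : Localization.AtPrime Q, (∃ e : ℕ, y ^ 5 ^ e ∈ Ideal.span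
            ((fun z : Localization.AtPrime Q => z ^ 5 ^ e) ''
              (Ideal.span (Set.range s) : Set (Localization.AtPrime Q)))) → y ∈ Ideal.span (Set.range s) := by
  haveI : Fact (Nat.Prime 5) := ⟨by norm_num⟩
  intro Q _ hj d hd s hs
  -- the five partial derivatives
  have hd0 : pderiv 0 g = 9 * X 0 ^ 2 * (X 1 ^ 2 + X 0 ^ 3) ^ 2 + 11 * X 0 ^ 10 := by
    rw [hg]
    simp only [map_add, Derivation.leibniz, pderiv_pow, pderiv_X_self, smul_eq_mul,
      pderiv_X_of_ne (show (1 : Fin 5) ≠ 0 by decide), pderiv_X_of_ne (show (2 : Fin 5) ≠ 0 by decide),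
      pderiv_X_of_ne (show (3 : Fin 5) ≠ 0 by decide), pderiv_X_of_ne (show (4 : Fin 5) ≠ 0 by decide)]
    norm_num
    ring
  have hd1 : pderiv 1 g = 2 * X 4 ^ 4 * X 1 * X 3 ^ 4 + 6 * X 1 * (X 1 ^ 2 + X 0 ^ 3) ^ 2 + 5 * X 1 ^ 4 * X 3 := by
    rw [hg]
    simp only [map_add, Derivation.leibniz, pderiv_pow, pderiv_X_self, smul_eq_mul,
      pderiv_X_of_ne (show (0 : Fin 5) ≠ 1 by decide), pderiv_X_of_ne (show (2 : Fin 5) ≠ 1 by decide),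
      pderiv_X_of_ne (show (3 : Fin 5) ≠ 1 by decide), pderiv_X_of_ne (show (4 : Fin 5) ≠ 1 by decide)]
    norm_num
    ring
  have hd2 : pderiv 2 g = 2 * X 2 := by
    rw [hg]
    simp only [map_add, Derivation.leibniz, pderiv_pow, pderiv_X_self, smul_eq_mul,
      pderiv_X_of_ne (show (0 : Fin 5) ≠ 2 by decide), pderiv_X_of_ne (show (1 : Fin 5) ≠ 2 by decide),
      pderiv_X_of_ne (show (3 : Fin 5) ≠ 2 by decide), pderiv_X_of_ne (show (4 : Fin 5) ≠ 2 by decide)]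
    norm_num
  have hd3 : pderiv 3 g = 4 * X 4 ^ 4 * X 1 ^ 2 * X 3 ^ 3 + X 1 ^ 5 + 7 * X 3 ^ 6 := by
    rw [hg]
    simp only [map_add, Derivation.leibniz, pderiv_pow, pderiv_X_self, smul_eq_mul,
      pderiv_X_of_ne (show (0 : Fin 5) ≠ 3 by decide), pderiv_X_of_ne (show (1 : Fin 5) ≠ 3 by decide),
      pderiv_X_of_ne (show (2 : Fin 5) ≠ 3 by decide), pderiv_X_of_ne (show (4 : Fin 5) ≠ 3 by decide)]
    norm_num
    ring
  have hd4 : pderiv 4 g = 4 * X 4 ^ 3 * X 1 ^ 2 * X 3 ^ 4 := by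
    rw [hg]
    simp only [map_add, Derivation.leibniz, pderiv_pow, pderiv_X_self, smul_eq_mul,
      pderiv_X_of_ne (show (0 : Fin 5) ≠ 4 by decide), pderiv_X_of_ne (show (1 : Fin 5) ≠ 4 by decide),
      pderiv_X_of_ne (show (2 : Fin 5) ≠ 4 by decide), pderiv_X_of_ne (show (3 : Fin 5) ≠ 4 by decide)]
    norm_num
    ring
  -- Jacobian exits: some partial is not in `P = Q ∩ k[X]`
  by_cases m0 : pderiv 0 g ∈ Q.comap (Ideal.Quotient.mk (Ideal.span {g})); swap
  · exact ClauseOfPderivNotMem.stub_clauseOfPderivNotMem 5 k 5 g Q 0 m0 d hd s hs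
  by_cases m1 : pderiv 1 g ∈ Q.comap (Ideal.Quotient.mk (Ideal.span {g})); swap
  · exact ClauseOfPderivNotMem.stub_clauseOfPderivNotMem 5 k 5 g Q 1 m1 d hd s hs
  by_cases m2 : pderiv 2 g ∈ Q.comap (Ideal.Quotient.mk (Ideal.span {g})); swap
  · exact ClauseOfPderivNotMem.stub_clauseOfPderivNotMem 5 k 5 g Q 2 m2 d hd s hs
  by_cases m3 : pderiv 3 g ∈ Q.comap (Ideal.Quotient.mk (Ideal.span {g})); swap
  · exact ClauseOfPderivNotMem.stub_clauseOfPderivNotMem 5 k 5 g Q 3 m3 d hd s hs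
  by_cases m4 : pderiv 4 g ∈ Q.comap (Ideal.Quotient.mk (Ideal.span {g})); swap
  · exact ClauseOfPderivNotMem.stub_clauseOfPderivNotMem 5 k 5 g Q 4 m4 d hd s hs
  -- all partials in `P`: impossible off `L`, by the residue-domain chain
  exfalso
  haveI hPmax : (Q.comap (Ideal.Quotient.mk (Ideal.span {g}))).IsMaximal :=
    Ideal.comap_isMaximal_of_surjective _ Ideal.Quotient.mk_surjective
  have hgP : g ∈ Q.comap (Ideal.Quotient.mk (Ideal.span {g})) := by
    rw [Ideal.mem_comap, Ideal.Quotient.eq_zero_iff_mem.mpr (Ideal.mem_span_singleton_self g)]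
    exact Q.zero_mem
  -- the residue domain `R = k[X] / P` has characteristic `5`
  haveI : Nontrivial (MvPolynomial (Fin 5) k ⧸ Q.comap (Ideal.Quotient.mk (Ideal.span {g}))) :=
    Ideal.Quotient.nontrivial_iff.mpr hPmax.ne_top
  haveI : CharP (MvPolynomial (Fin 5) k ⧸ Q.comap (Ideal.Quotient.mk (Ideal.span {g}))) 5 :=
    charP_of_injective_algebraMap
      (algebraMap k (MvPolynomial (Fin 5) k ⧸ Q.comap (Ideal.Quotient.mk (Ideal.span {g})))).injective 5
  have h5 : (5 : MvPolynomial (Fin 5) k ⧸ Q.comap (Ideal.Quotient.mk (Ideal.span {g}))) = 0 := by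
    simpa using CharP.cast_eq_zero (MvPolynomial (Fin 5) k ⧸ Q.comap (Ideal.Quotient.mk (Ideal.span {g}))) 5
  set π := Ideal.Quotient.mk (Q.comap (Ideal.Quotient.mk (Ideal.span {g}))) with hπdef
  have hπ : ∀ a : MvPolynomial (Fin 5) k, a ∈ Q.comap (Ideal.Quotient.mk (Ideal.span {g})) → π a = 0 :=
    fun a ha => Ideal.Quotient.eq_zero_iff_mem.mpr ha
  -- the six equations in the residue domain
  have eg : π (X 2 ^ 2 + X 4 ^ 4 * X 1 ^ 2 * X 3 ^ 4 + (X 1 ^ 2 + X 0 ^ 3) ^ 3 + X 1 ^ 5 * X 3 + X 0 ^ 11 + X 3 ^ 7) = 0 := by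
    rw [← hg]
    exact hπ g hgP
  have e0 := hπ _ m0
  have e1 := hπ _ m1
  have e2 := hπ _ m2
  have e3 := hπ _ m3
  have e4 := hπ _ m4
  rw [hd0] at e0
  rw [hd1] at e1
  rw [hd2] at e2
  rw [hd3] at e3
  rw [hd4] at e4
  simp only [map_add, map_mul, map_pow, map_ofNat] at eg e0 e1 e2 e3 e4
  obtain ⟨hx, hy, hz, hw⟩ := eq_zero_of_jacobian h5 (π (X 0)) (π (X 1)) (π (X 2)) (π (X 3)) (π (X 4)) eg e0 e1 e2 e3 e4
  -- but some `x̄ⱼ ∉ Q`, `j ≤ 3`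
  obtain ⟨j, hjJ, hjQ⟩ := hj
  apply hjQ
  have key : ∀ i : Fin 5, π (X i) = 0 → Ideal.Quotient.mk (Ideal.span {g}) (X i) ∈ Q := fun i hi =>
    Ideal.mem_comap.mp (Ideal.Quotient.eq_zero_iff_mem.mp hi)
  simp only [Finset.mem_insert, Finset.mem_singleton] at hjJ
  rcases hjJ with rfl | rfl | rfl | rfl
  · exact key 0 hx
  · exact key 1 hy
  · exact key 2 hz
  · exact key 3 hw

end Summit.ResolutionOfSingularities.ResolutionOfSingularities.Theorems.FInjectiveMacaulayfication.RelGddF211Regular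

end
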